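import Mathlib
import Literature.Algebra.Polynomial.KroneckerCertificate
import HarnessLib

/-!
# Kronecker substitution for signed integer sequences: packing, balanced decoding,
# convolution, correlation, accumulation and length recovery

This file records the classical soundness facts behind *exact integer convolution by
Kronecker substitution* ("pack the coefficients into one big integer, multiply once, read the
coefficients of the product off the digits"), in the signed, balanced-digit form in which it is
used by the `cap` validated-numerics engine (`cap.iconv`, soundness anchor #5: one big-integer
product replaces a quadratic-time convolution of scaled interval midpoints / weighted `ℓ¹`
Fourier coefficients; every statement below is a cited textbook fact).

The companion file `Literature.Algebra.Polynomial.KroneckerCertificate` proves the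
*injectivity* of Kronecker substitution (`x ↦ B`) on polynomials with small coefficients and
uses it to certify polynomial identities.  Here we prove the complementary *decoding* facts:

1. **Packing** (`pack B p = p.eval B`) is a ring homomorphism, and equals the byte-string
   concatenation `∑ c_j B^j = ∑ c_j⁺ B^j - ∑ c_j⁻ B^j`
   [BrentZimmermann2010, §1.3; GathenGerhard1999, §8.4].
2. **Coefficients of a product = convolution**: the reference double loop, the length
   `la + lb - 1`, and the bound `|(p q)_n| ≤ min(la, lb) · ma · mb`
   [Harvey2009, §3, (3.1); BrentZimmermann2010, §1.3; GathenGerhard1999, §8.4].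
3. **Balanced decoding**: if every coefficient satisfies `-H ≤ c_n < H` and `B = 2H`, then
   adding the offset `∑ H B^n` makes all digits non-negative, and the `n`-th base-`B` digit of
   `pack B p + offset`, minus `H`, is `c_n`; the shifted integer lies in `[0, B^L)`
   [KnuthTAOCP2, §4.1 (balanced number systems, conversion rule (8)); BrentZimmermann2010,
   §1.3 and Exercise 1.1].
4. **The byte-width rule**: with `bits = size ma + size mb + size (min la lb)`,
   `W = ⌈(bits+1)/8⌉` bytes and `H = 2^(8W-1)`, one has `min(la,lb)·ma·mb < 2^bits ≤ H`, so the
   convolution of two bounded integer sequences is decoded exactly from one product of packed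
   integers (`conv_eq_decode`) [BrentZimmermann2010, §1.3 ("`β^k > n ρ²`"); Harvey2009, Prop. 5].
5. **Correlation by reversal**: `R(d) = ∑_{j-k=d} a_j b_k` is the convolution of `a` with the
   reversed `b`, read at lag `lb - 1 + d` [Harvey2009, §3.2], so the same decoding applies
   (`corrPos_eq_decode`, `corrNeg_eq_decode`).
6. **Accumulation in the transform domain**: packing is additive, so a sum of `T` products of
   packed integers decodes to the sum of the `T` convolutions as long as the accumulated
   coefficients stay below `H`; the rule `bits = ba + bb + size nmin + size (T-1)` guarantees it
   (`decode_sum_pack_mul`, `natAbs_sum_coeff_mul_lt`) [Harvey2009, §3, (3.1);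
   BrentZimmermann2010, §1.3].
7. **Length recovery**: a packed integer with balanced digits determines the number of digits
   from its bit length: `B^(deg p) < 2 |pack B p|`, whence `deg p < size |pack B p| / (8W) + 2`
   [KnuthTAOCP2, §4.1, property (b) of balanced notation].

## Dictionary with the validated-numerics kernel (`cap.iconv`)

* a list `a` of `la` Python integers with `max |a_j| = ma`  ↦  `p : ℤ[X]` with
  `CoeffBound p la ma` (from the companion file: `p.natDegree < la ∧ ∀ k, |p_k| ≤ ma`);
* `_pack(a, W)` ↦ `pack (256^W) p` (`pack_eq_posPart_sub_negPart` is literally the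
  "positive bytes minus negative bytes" implementation); `_width` ↦ `width`, `H` ↦ `half W`;
* `_unpack(P, W, L)[n]` ↦ `decode (half W) L P n` (the `n`-th `W`-byte field of `P + off`,
  minus `half`), its two `assert`s ↦ `offset_add_pack_nonneg`, `offset_add_pack_lt`;
* `conv_ref` ↦ `coeff_mul_eq_double_sum`; `conv` ↦ `conv_eq_decode` (the `W = 0` shortcut for
  an all-zero input is `p = 0 ∨ q = 0 ⇒ p q = 0`);
  `corr_ref`/`corr` (`pos[d]`, `0 ≤ d < la`, and `neg[e]`, `1 ≤ e < lb`, read at slots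
  `lb-1+d` / `lb-1-e` of `conv(a, b[::-1])`) ↦ `corrPos_eq_decode`, `corrNeg_eq_decode`;
* `domain(bits_a, bits_b, nmin, terms)` ↦ `accBits` / `accWidth`; `_KDom.enc_rev` ↦
  `reflect (lb-1)`; `_KDom.mul` / `_KDom.add` ↦ `pack_mul` / `pack_add` (`sum_pack_mul_pack`);
  `_KDom.dec(acc, L)` with `Lf = max(L, bitlength|acc| // (8W) + 2)` ↦ `acc_eq_decode_lenBound`
  (via `natAbs_sum_coeff_mul_lt`, `natDegree_lt_lenBound`), or `acc_eq_decode` when `L`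
  exceeds every product length.

Not formalised: byte-level I/O (`int.to_bytes` / `from_bytes` are, by their specification,
base-`256^W` digit strings), the GMP/FLINT back ends, the small-size cut-off, floating-point
callers.  Everything here is exact integer arithmetic.
-/

namespace Literature.Algebra.Polynomial.KroneckerSubstitution

open _root_.Polynomial Finset
open Literature.Algebra.Polynomial.PolyCert (CoeffBound)

variable {p q : ℤ[X]} {la lb ma mb : ℕ}

/-! ### 1. Packing -/

/-- Kronecker substitution `x ↦ B`: the integer `pack B p = p(B) = ∑ c_j B^j` packing the
coefficient sequence of `p` into one integer, base `B`.
[cite: BrentZimmermann2010, §1.3] -/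
def pack (B : ℕ) (p : ℤ[X]) : ℤ := p.eval (B : ℤ)

/-- `pack B p = ∑_{j<L} c_j B^j` for any length bound `L > deg p`.
[cite: BrentZimmermann2010, §1.3] -/
theorem pack_eq_sum (B : ℕ) {L : ℕ} (h : p.natDegree < L) :
    pack B p = ∑ j ∈ range L, p.coeff j * (B : ℤ) ^ j :=
  eval_eq_sum_range' h _

/-- Packing is multiplicative: `C(B) = A(B) · B(B)` — one integer product computes the packed
product polynomial. [cite: BrentZimmermann2010, §1.3] [cite: GathenGerhard1999, §8.4] -/
theorem pack_mul (B : ℕ) (p q : ℤ[X]) : pack B (p * q) = pack B p * pack B q := eval_mul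

/-- Packing is additive (accumulation in the "transform domain").
[cite: BrentZimmermann2010, §1.3] -/
theorem pack_add (B : ℕ) (p q : ℤ[X]) : pack B (p + q) = pack B p + pack B q := eval_add

/-- Packing the zero sequence gives `0`. [cite: BrentZimmermann2010, §1.3] -/
theorem pack_zero (B : ℕ) : pack B (0 : ℤ[X]) = 0 := eval_zero

/-- Packing commutes with finite sums. [cite: BrentZimmermann2010, §1.3] -/
theorem pack_sum {ι : Type*} (B : ℕ) (s : Finset ι) (f : ι → ℤ[X]) :
    pack B (∑ t ∈ s, f t) = ∑ t ∈ s, pack B (f t) :=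
  eval_finsetSum _ _ _

/-- The signed packing is the difference of two non-negative digit strings: the positive parts
and the negative parts of the coefficients ("split `f` into its positive and negative part").
[cite: GathenGerhard1999, §8.4] [cite: BrentZimmermann2010, §1.3] -/
theorem pack_eq_posPart_sub_negPart (B : ℕ) {L : ℕ} (h : p.natDegree < L) :
    pack B p = (∑ j ∈ range L, (p.coeff j)⁺ * (B : ℤ) ^ j)
      - ∑ j ∈ range L, (p.coeff j)⁻ * (B : ℤ) ^ j := by
  rw [← Finset.sum_sub_distrib, pack_eq_sum B h]
  refine Finset.sum_congr rfl fun j _ => ?_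
  rw [← sub_mul, posPart_sub_negPart]

/-- `c⁺ ≤ |c|` and `c⁻ ≤ |c|`. [folklore] -/
private theorem posPart_le_natAbs_and (c : ℤ) : c⁺ ≤ (c.natAbs : ℤ) ∧ c⁻ ≤ (c.natAbs : ℤ) := by
  rw [posPart_def, negPart_def, Int.natCast_natAbs]
  exact ⟨sup_le (le_abs_self c) (abs_nonneg c), sup_le (neg_le_abs c) (abs_nonneg c)⟩

/-! ### 2. Coefficients of the product: the convolution -/

/-- The reference double loop: `(p q)_n = ∑_{j<la} ∑_{k<lb} [j+k=n] p_j q_k`.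
[cite: GathenGerhard1999, §8.4] [cite: BrentZimmermann2010, §1.3] -/
theorem coeff_mul_eq_double_sum (hp : p.natDegree < la) (hq : q.natDegree < lb) (n : ℕ) :
    (p * q).coeff n =
      ∑ j ∈ range la, ∑ k ∈ range lb, if j + k = n then p.coeff j * q.coeff k else 0 := by
  conv_lhs => rw [p.as_sum_range_C_mul_X_pow' hp, q.as_sum_range_C_mul_X_pow' hq,
    Finset.sum_mul]
  simp_rw [Finset.mul_sum, finsetSum_coeff]
  refine Finset.sum_congr rfl fun j _ => Finset.sum_congr rfl fun k _ => ?_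
  rw [show C (p.coeff j) * X ^ j * (C (q.coeff k) * X ^ k)
      = C (p.coeff j * q.coeff k) * X ^ (j + k) by
    rw [mul_mul_mul_comm, ← C_mul, ← pow_add], coeff_C_mul_X_pow]
  by_cases hjk : j + k = n
  · rw [if_pos hjk.symm, if_pos hjk]
  · rw [if_neg (Ne.symm hjk), if_neg hjk]

/-- The product of sequences of lengths `la`, `lb` has length `la + lb - 1`.
[cite: BrentZimmermann2010, §1.3] -/
theorem natDegree_mul_lt (hp : CoeffBound p la ma) (hq : CoeffBound q lb mb) :
    (p * q).natDegree < la + lb - 1 :=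
  (hp.mul hq).1

/-- The coefficient bound of the product: `|(p q)_n| ≤ min(la, lb) · ma · mb` (each output
coefficient is a sum of at most `min(la, lb)` products). [cite: Harvey2009, §3, (3.1)]
[cite: BrentZimmermann2010, §1.3] [cite: GathenGerhard1999, §8.4] -/
theorem natAbs_coeff_mul_le (hp : CoeffBound p la ma) (hq : CoeffBound q lb mb) (n : ℕ) :
    ((p * q).coeff n).natAbs ≤ min la lb * (ma * mb) := by
  rcases le_total la lb with h | h
  · rw [min_eq_left h, ← mul_assoc]
    exact (hp.mul hq).2 n
  · rw [min_eq_right h, mul_comm p q, mul_comm ma mb, ← mul_assoc]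
    exact (hq.mul hp).2 n

/-! ### 3. Balanced decoding -/

/-- The offset `∑_{n<L} H (2H)^n`: the integer all of whose `L` base-`2H` digits equal `H`.
Adding it shifts balanced digits `c_n ∈ [-H, H)` to ordinary digits `c_n + H ∈ [0, 2H)`.
[cite: KnuthTAOCP2, §4.1] -/
def offset (H L : ℕ) : ℤ := ∑ n ∈ range L, (H : ℤ) * (2 * H : ℤ) ^ n

/-- Balanced base-`2H` digit extraction: the `n`-th digit of `P + offset`, re-centred by `-H`.
[cite: KnuthTAOCP2, §4.1] [cite: BrentZimmermann2010, Exercise 1.1] -/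
def decode (H L : ℕ) (P : ℤ) (n : ℕ) : ℤ :=
  (P + offset H L) / (2 * H : ℤ) ^ n % (2 * H : ℤ) - H

/-- Reading digits off a positional expansion: if `0 ≤ d_i < B` for `i < L`, the `n`-th base-`B`
digit of `∑_{i<L} d_i B^i` is `d_n`. [cite: KnuthTAOCP2, §4.1] -/
theorem sum_mul_pow_div_pow_emod {B : ℤ} (hB : 0 < B) :
    ∀ (n L : ℕ) (d : ℕ → ℤ), (∀ i < L, 0 ≤ d i ∧ d i < B) → n < L →
      (∑ i ∈ range L, d i * B ^ i) / B ^ n % B = d n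
  | _, 0, _, _, hn => absurd hn (Nat.not_lt_zero _)
  | 0, L + 1, d, hd, _ => by
      have hsplit : ∑ i ∈ range L, d (i + 1) * B ^ (i + 1)
          = B * ∑ i ∈ range L, d (i + 1) * B ^ i := by
        rw [Finset.mul_sum]
        exact Finset.sum_congr rfl fun i _ => by ring
      rw [Finset.sum_range_succ', hsplit, pow_zero, mul_one, Int.ediv_one,
        Int.mul_add_emod_self_left]
      exact Int.emod_eq_of_lt (hd 0 (Nat.succ_pos L)).1 (hd 0 (Nat.succ_pos L)).2
  | n + 1, L + 1, d, hd, hn => by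
      have hsplit : ∑ i ∈ range L, d (i + 1) * B ^ (i + 1)
          = (∑ i ∈ range L, d (i + 1) * B ^ i) * B := by
        rw [Finset.sum_mul]
        exact Finset.sum_congr rfl fun i _ => by ring
      rw [Finset.sum_range_succ', hsplit, pow_zero, mul_one, pow_succ',
        ← Int.ediv_ediv_of_nonneg hB.le, add_comm, Int.add_mul_ediv_right _ _ hB.ne',
        Int.ediv_eq_zero_of_lt (hd 0 (Nat.succ_pos L)).1 (hd 0 (Nat.succ_pos L)).2, zero_add]
      exact sum_mul_pow_div_pow_emod hB n L (fun i => d (i + 1))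
        (fun i hi => hd (i + 1) (Nat.succ_lt_succ hi)) (Nat.lt_of_succ_lt_succ hn)

/-- A positional expansion with digits in `[0, B)` lies in `[0, B^L)`.
[cite: KnuthTAOCP2, §4.1] -/
theorem sum_mul_pow_mem_Ico {B : ℤ} (hB : 0 < B) (d : ℕ → ℤ) :
    ∀ L : ℕ, (∀ i < L, 0 ≤ d i ∧ d i < B) →
      0 ≤ ∑ i ∈ range L, d i * B ^ i ∧ ∑ i ∈ range L, d i * B ^ i < B ^ L
  | 0, _ => by simp
  | L + 1, hd => by
      obtain ⟨h0, hlt⟩ := sum_mul_pow_mem_Ico hB d L fun i hi => hd i (Nat.lt_succ_of_lt hi)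
      obtain ⟨hd0, hdB⟩ := hd L (Nat.lt_succ_self L)
      have hBL : 0 < B ^ L := pow_pos hB L
      refine ⟨?_, ?_⟩
      · rw [Finset.sum_range_succ]
        positivity
      · rw [Finset.sum_range_succ, pow_succ]
        have h1 : d L * B ^ L ≤ (B - 1) * B ^ L :=
          mul_le_mul_of_nonneg_right (by omega) hBL.le
        linarith

/-- The shifted packing `pack (2H) p + offset H L` is the positional expansion with the
non-negative digits `c_i + H`. [cite: KnuthTAOCP2, §4.1] [cite: BrentZimmermann2010, §1.3] -/
theorem pack_add_offset {H L : ℕ} (hdeg : p.natDegree < L) :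
    pack (2 * H) p + offset H L = ∑ i ∈ range L, (p.coeff i + H) * (2 * H : ℤ) ^ i := by
  rw [pack_eq_sum _ hdeg, offset, ← Finset.sum_add_distrib]
  refine Finset.sum_congr rfl fun i _ => ?_
  push_cast
  ring

/-- **Balanced decoding.** If `deg p < L` and every coefficient satisfies `-H ≤ c_n < H`, then
for `n < L` the `n`-th balanced base-`2H` digit of `pack (2H) p` is `c_n`: the offset turns the
balanced digits into ordinary digits, which are read off and re-centred.
[cite: KnuthTAOCP2, §4.1] [cite: BrentZimmermann2010, §1.3 and Exercise 1.1] -/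
theorem decode_pack {H L : ℕ} (hH : 0 < H) (hdeg : p.natDegree < L)
    (hc : ∀ n, -(H : ℤ) ≤ p.coeff n ∧ p.coeff n < H) {n : ℕ} (hn : n < L) :
    decode H L (pack (2 * H) p) n = p.coeff n := by
  unfold decode
  rw [pack_add_offset hdeg, sum_mul_pow_div_pow_emod (by positivity) n L
    (fun i => p.coeff i + H) (fun i _ => ⟨by linarith [(hc i).1], by linarith [(hc i).2]⟩) hn]
  ring

/-- First range assertion of the decoder: the shifted integer is non-negative.
[cite: KnuthTAOCP2, §4.1] -/
theorem offset_add_pack_nonneg {H L : ℕ} (hH : 0 < H) (hdeg : p.natDegree < L)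
    (hc : ∀ n, -(H : ℤ) ≤ p.coeff n ∧ p.coeff n < H) :
    0 ≤ pack (2 * H) p + offset H L := by
  rw [pack_add_offset hdeg]
  exact (sum_mul_pow_mem_Ico (B := 2 * H) (by positivity) (fun i => p.coeff i + H) L
    fun i _ => ⟨by linarith [(hc i).1], by linarith [(hc i).2]⟩).1

/-- Second range assertion of the decoder: the shifted integer has at most `L` base-`2H`
digits (it fits in `L` slots). [cite: KnuthTAOCP2, §4.1] -/
theorem offset_add_pack_lt {H L : ℕ} (hH : 0 < H) (hdeg : p.natDegree < L)
    (hc : ∀ n, -(H : ℤ) ≤ p.coeff n ∧ p.coeff n < H) :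
    pack (2 * H) p + offset H L < (2 * H : ℤ) ^ L := by
  rw [pack_add_offset hdeg]
  exact (sum_mul_pow_mem_Ico (B := 2 * H) (by positivity) (fun i => p.coeff i + H) L
    fun i _ => ⟨by linarith [(hc i).1], by linarith [(hc i).2]⟩).2

/-- A `natAbs` bound `|c| < H` gives the balanced-digit range `-H ≤ c < H`. [folklore] -/
private theorem balanced_of_natAbs_lt {H : ℕ} (hc : ∀ n, (p.coeff n).natAbs < H) (n : ℕ) :
    -(H : ℤ) ≤ p.coeff n ∧ p.coeff n < H := by
  have := hc n
  omega

/-! ### 4. Decoding a product: exact convolution, and the byte-width rule -/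

/-- **Exact convolution by one integer product.** If `|p_j| ≤ ma` (`j < la`), `|q_k| ≤ mb`
(`k < lb`) and the half-base `H` exceeds `min(la,lb)·ma·mb`, then every coefficient of `p q`
is recovered from the single integer product `pack (2H) p · pack (2H) q` by balanced decoding.
[cite: BrentZimmermann2010, §1.3 and Exercise 1.1] [cite: Harvey2009, §3, (3.1)] -/
theorem decode_pack_mul_pack {H : ℕ} (hp : CoeffBound p la ma) (hq : CoeffBound q lb mb)
    (hH : min la lb * (ma * mb) < H) {n : ℕ} (hn : n < la + lb - 1) :
    decode H (la + lb - 1) (pack (2 * H) p * pack (2 * H) q) n = (p * q).coeff n := by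
  rw [← pack_mul]
  refine decode_pack (by omega) (hp.mul hq).1 (balanced_of_natAbs_lt fun k => ?_) hn
  exact lt_of_le_of_lt (natAbs_coeff_mul_le hp hq k) hH

/-- The bit budget of the kernel: `bits = size ma + size mb + size (min la lb)` (binary lengths).
[cite: Harvey2009, §3, (3.1)] -/
def bits (la lb ma mb : ℕ) : ℕ := Nat.size ma + Nat.size mb + Nat.size (min la lb)

/-- The slot width in bytes: `W = ⌈(bits + 1) / 8⌉` (one extra bit for the sign / balance).
[cite: BrentZimmermann2010, §1.3] -/
def width (la lb ma mb : ℕ) : ℕ := (bits la lb ma mb + 8) / 8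

/-- The half-base of a `W`-byte slot: `H = 2^(8W-1)`, so that the base is `2H = 256^W`.
[cite: KnuthTAOCP2, §4.1] -/
def half (W : ℕ) : ℕ := 2 ^ (8 * W - 1)

/-- The product coefficient bound is below `2^bits`: `min(la,lb)·ma·mb < 2^(size ma + size mb
+ size min(la,lb))`. [cite: Harvey2009, §3, (3.1)] -/
theorem bound_lt_two_pow_bits (la lb ma mb : ℕ) :
    min la lb * (ma * mb) < 2 ^ bits la lb ma mb := by
  unfold bits
  have h1 := Nat.lt_size_self ma
  have h2 := Nat.lt_size_self mb
  have h3 := Nat.lt_size_self (min la lb)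
  rw [pow_add, pow_add]
  have key : (min la lb + 1) * ((ma + 1) * (mb + 1))
      ≤ 2 ^ (min la lb).size * (2 ^ ma.size * 2 ^ mb.size) :=
    Nat.mul_le_mul h3 (Nat.mul_le_mul h1 h2)
  have lt : min la lb * (ma * mb) < (min la lb + 1) * ((ma + 1) * (mb + 1)) := by
    have : (min la lb + 1) * ((ma + 1) * (mb + 1)) = min la lb * (ma * mb)
        + (min la lb * ma + min la lb * mb + min la lb + ma * mb + ma + mb + 1) := by ring
    omega
  calc min la lb * (ma * mb) < (min la lb + 1) * ((ma + 1) * (mb + 1)) := lt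
    _ ≤ 2 ^ (min la lb).size * (2 ^ ma.size * 2 ^ mb.size) := key
    _ = 2 ^ ma.size * 2 ^ mb.size * 2 ^ (min la lb).size := by ring

/-- The width rule leaves a spare bit: `bits < 8 W`, i.e. `bits ≤ 8W - 1`.
[cite: BrentZimmermann2010, §1.3] -/
theorem bits_lt_eight_mul_width (la lb ma mb : ℕ) :
    bits la lb ma mb < 8 * width la lb ma mb := by
  unfold width
  omega

/-- The width is at least one byte. [cite: BrentZimmermann2010, §1.3] -/
theorem one_le_width (la lb ma mb : ℕ) : 1 ≤ width la lb ma mb := by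
  unfold width
  omega

/-- The base of a `W`-byte slot: `2 H = 2^(8W) = 256^W` (`W ≥ 1`). [cite: KnuthTAOCP2, §4.1] -/
theorem two_mul_half {W : ℕ} (hW : 1 ≤ W) : 2 * half W = 256 ^ W := by
  unfold half
  rw [← pow_succ', show 8 * W - 1 + 1 = 8 * W by omega, pow_mul]
  norm_num

/-- The half-base is positive. [cite: KnuthTAOCP2, §4.1] -/
theorem half_pos (W : ℕ) : 0 < half W := by
  unfold half
  positivity

/-- `2^bits ≤ H`: the coefficient budget fits below the half-base of the chosen width.
[cite: BrentZimmermann2010, §1.3] -/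
theorem two_pow_bits_le_half (la lb ma mb : ℕ) :
    2 ^ bits la lb ma mb ≤ half (width la lb ma mb) := by
  unfold half
  exact Nat.pow_le_pow_right (by norm_num) (by have := bits_lt_eight_mul_width la lb ma mb; omega)

/-- Hence the width rule makes the half-base exceed the product coefficient bound.
[cite: BrentZimmermann2010, §1.3] [cite: Harvey2009, §3, (3.1)] -/
theorem bound_lt_half_width (la lb ma mb : ℕ) :
    min la lb * (ma * mb) < half (width la lb ma mb) :=
  lt_of_lt_of_le (bound_lt_two_pow_bits la lb ma mb) (two_pow_bits_le_half la lb ma mb)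

/-- Each input coefficient fits in its `W`-byte field: `|p_j| < 256^W`.
[cite: GathenGerhard1999, §8.4] -/
theorem natAbs_coeff_lt_base (hp : CoeffBound p la ma) (lb mb j : ℕ) :
    (p.coeff j).natAbs < 256 ^ width la lb ma mb := by
  rw [← two_mul_half (one_le_width la lb ma mb)]
  have h1 : (p.coeff j).natAbs ≤ ma := hp.2 j
  have h2 : ma < 2 ^ Nat.size ma := Nat.lt_size_self ma
  have h3 : 2 ^ Nat.size ma ≤ 2 ^ bits la lb ma mb :=
    Nat.pow_le_pow_right (by norm_num) (by unfold bits; omega)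
  have h4 := two_pow_bits_le_half la lb ma mb
  omega

/-- The byte fields of the split packing `∑ c_j⁺ 256^(Wj) - ∑ c_j⁻ 256^(Wj)` fit in `W` bytes:
`c_j⁺ < 256^W` and `c_j⁻ < 256^W` ("split `f` and `g` into positive and negative parts", each
packed with non-negative digits). [cite: GathenGerhard1999, §8.4] -/
theorem posPart_coeff_lt_base (hp : CoeffBound p la ma) (lb mb j : ℕ) :
    (p.coeff j)⁺ < ((256 ^ width la lb ma mb : ℕ) : ℤ)
      ∧ (p.coeff j)⁻ < ((256 ^ width la lb ma mb : ℕ) : ℤ) := by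
  obtain ⟨h1, h2⟩ := posPart_le_natAbs_and (p.coeff j)
  have h3 : ((p.coeff j).natAbs : ℤ) < ((256 ^ width la lb ma mb : ℕ) : ℤ) := by
    exact_mod_cast natAbs_coeff_lt_base hp lb mb j
  exact ⟨lt_of_le_of_lt h1 h3, lt_of_le_of_lt h2 h3⟩

/-- **The kernel's convolution is exact.** With the byte width `W = width la lb ma mb` and
`H = 2^(8W-1)`, for all `n < la + lb - 1`:
`(p q)_n = decode H (la+lb-1) (pack (256^W) p · pack (256^W) q) n`.
[cite: BrentZimmermann2010, §1.3 and Exercise 1.1] [cite: Harvey2009, Proposition 5] -/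
theorem conv_eq_decode (hp : CoeffBound p la ma) (hq : CoeffBound q lb mb) {n : ℕ}
    (hn : n < la + lb - 1) :
    (p * q).coeff n = decode (half (width la lb ma mb)) (la + lb - 1)
      (pack (256 ^ width la lb ma mb) p * pack (256 ^ width la lb ma mb) q) n := by
  rw [← two_mul_half (one_le_width la lb ma mb),
    decode_pack_mul_pack hp hq (bound_lt_half_width la lb ma mb) hn]

/-! ### 5. Correlation by reversal -/

/-- Non-negative lags of the cross-correlation: `R(d) = ∑_{j-k=d} p_j q_k = ∑_{k<lb} p_{k+d} q_k`
(`d ≥ 0`). [cite: Harvey2009, §3.2] -/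
def corrPos (lb : ℕ) (p q : ℤ[X]) (d : ℕ) : ℤ := ∑ k ∈ range lb, p.coeff (k + d) * q.coeff k

/-- Negative lags of the cross-correlation: `R(-e) = ∑_{j-k=-e} p_j q_k = ∑_{j<la} p_j q_{j+e}`.
[cite: Harvey2009, §3.2] -/
def corrNeg (la : ℕ) (p q : ℤ[X]) (e : ℕ) : ℤ := ∑ j ∈ range la, p.coeff j * q.coeff (j + e)

/-- The reversed sequence: for `i < lb`, `(reflect (lb-1) q)_i = q_{lb-1-i}` (`b[::-1]`).
[cite: Harvey2009, §3.2] -/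
theorem coeff_reflect_of_lt {i : ℕ} (hi : i < lb) :
    (reflect (lb - 1) q).coeff i = q.coeff (lb - 1 - i) := by
  rw [coeff_reflect, revAt_le (by omega)]

/-- Reversal preserves the length and coefficient bounds. [cite: Harvey2009, §3.2] -/
theorem coeffBound_reflect (hq : CoeffBound q lb mb) : CoeffBound (reflect (lb - 1) q) lb mb := by
  refine ⟨lt_of_le_of_lt natDegree_reflect_le ?_, fun k => ?_⟩
  · have := hq.1
    exact max_lt (by omega) this
  · rw [coeff_reflect]
    exact hq.2 _

/-- Coefficients of `p · reflect N q`: `(p · q̃)_m = ∑_{j ≤ m} p_j q_{revAt N (m-j)}`.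
[cite: Harvey2009, §3.2] -/
theorem coeff_mul_reflect (p q : ℤ[X]) (N m : ℕ) :
    (p * reflect N q).coeff m = ∑ j ∈ range (m + 1), p.coeff j * q.coeff (revAt N (m - j)) := by
  rw [coeff_mul, Finset.Nat.sum_antidiagonal_eq_sum_range_succ
    (fun i j => p.coeff i * (reflect N q).coeff j)]
  exact Finset.sum_congr rfl fun j _ => by rw [coeff_reflect]

/-- Truncating a `range` sum whose summand vanishes from `min A B` on. [folklore] -/
private theorem sum_range_eq_of_eq_zero_from {g : ℕ → ℤ} {A B : ℕ} (h : ∀ j, min A B ≤ j → g j = 0) :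
    ∑ j ∈ range A, g j = ∑ j ∈ range B, g j := by
  have hA : ∑ j ∈ range (min A B), g j = ∑ j ∈ range A, g j :=
    Finset.sum_subset (range_subset_range.2 (min_le_left A B)) fun j _ hj =>
      h j (by rw [Finset.mem_range, not_lt] at hj; exact hj)
  have hB : ∑ j ∈ range (min A B), g j = ∑ j ∈ range B, g j :=
    Finset.sum_subset (range_subset_range.2 (min_le_right A B)) fun j _ hj =>
      h j (by rw [Finset.mem_range, not_lt] at hj; exact hj)
  rw [← hA, hB]

/-- **Correlation = convolution with the reversed sequence, non-negative lags**:
`R(d) = (p · reflect (lb-1) q)_{lb-1+d}`. [cite: Harvey2009, §3.2] -/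
theorem corrPos_eq_coeff (hq : q.natDegree < lb) (d : ℕ) :
    corrPos lb p q d = (p * reflect (lb - 1) q).coeff (lb - 1 + d) := by
  have hlb : 1 ≤ lb := Nat.one_le_of_lt hq
  rw [coeff_mul_reflect, show lb - 1 + d + 1 = d + lb by omega, Finset.sum_range_add]
  have hzero : ∑ j ∈ range d, p.coeff j * q.coeff (revAt (lb - 1) (lb - 1 + d - j)) = 0 := by
    refine Finset.sum_eq_zero fun j hj => ?_
    rw [Finset.mem_range] at hj
    rw [revAt_eq_self_of_lt (by omega), coeff_eq_zero_of_natDegree_lt (p := q) (by omega),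
      mul_zero]
  rw [hzero, zero_add, corrPos]
  refine Finset.sum_congr rfl fun k hk => ?_
  rw [Finset.mem_range] at hk
  rw [show lb - 1 + d - (d + k) = lb - 1 - k by omega, revAt_le (by omega),
    show lb - 1 - (lb - 1 - k) = k by omega, add_comm d k]

/-- **Correlation = convolution with the reversed sequence, negative lags**:
`R(-e) = (p · reflect (lb-1) q)_{lb-1-e}` for `1 ≤ e ≤ lb - 1` (indeed for `e ≤ lb - 1`).
[cite: Harvey2009, §3.2] -/
theorem corrNeg_eq_coeff (hp : p.natDegree < la) (hq : q.natDegree < lb) {e : ℕ}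
    (he : e ≤ lb - 1) :
    corrNeg la p q e = (p * reflect (lb - 1) q).coeff (lb - 1 - e) := by
  rw [coeff_mul_reflect, corrNeg]
  have hrev : ∀ j ∈ range (lb - 1 - e + 1),
      p.coeff j * q.coeff (revAt (lb - 1) (lb - 1 - e - j)) = p.coeff j * q.coeff (j + e) := by
    intro j hj
    rw [Finset.mem_range] at hj
    rw [revAt_le (by omega), show lb - 1 - (lb - 1 - e - j) = j + e by omega]
  rw [Finset.sum_congr rfl hrev]
  refine sum_range_eq_of_eq_zero_from fun j hj => ?_
  rcases Nat.lt_or_ge j la with hjla | hjla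
  · rw [coeff_eq_zero_of_natDegree_lt (p := q) (by omega), mul_zero]
  · rw [coeff_eq_zero_of_natDegree_lt (p := p) (by omega), zero_mul]

/-- **The kernel's correlation is exact, non-negative lags**: with `W = width la lb ma mb`,
`H = 2^(8W-1)` and `q̃ = reflect (lb-1) q` (the reversed list), for `d < la`:
`R(d) = decode H (la+lb-1) (pack (256^W) p · pack (256^W) q̃) (lb-1+d)`.
[cite: Harvey2009, §3.2] [cite: BrentZimmermann2010, §1.3] -/
theorem corrPos_eq_decode (hp : CoeffBound p la ma) (hq : CoeffBound q lb mb) {d : ℕ}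
    (hd : d < la) :
    corrPos lb p q d = decode (half (width la lb ma mb)) (la + lb - 1)
      (pack (256 ^ width la lb ma mb) p * pack (256 ^ width la lb ma mb) (reflect (lb - 1) q))
      (lb - 1 + d) := by
  have h1 := hq.1
  rw [corrPos_eq_coeff hq.1, conv_eq_decode (n := lb - 1 + d) hp (coeffBound_reflect hq)
    (by omega)]

/-- **The kernel's correlation is exact, negative lags**: for `1 ≤ e ≤ lb - 1`,
`R(-e) = decode H (la+lb-1) (pack (256^W) p · pack (256^W) q̃) (lb-1-e)`.
[cite: Harvey2009, §3.2] [cite: BrentZimmermann2010, §1.3] -/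
theorem corrNeg_eq_decode (hp : CoeffBound p la ma) (hq : CoeffBound q lb mb) {e : ℕ}
    (he : e ≤ lb - 1) :
    corrNeg la p q e = decode (half (width la lb ma mb)) (la + lb - 1)
      (pack (256 ^ width la lb ma mb) p * pack (256 ^ width la lb ma mb) (reflect (lb - 1) q))
      (lb - 1 - e) := by
  have h1 := hp.1
  have h2 := hq.1
  rw [corrNeg_eq_coeff hp.1 hq.1 he, conv_eq_decode (n := lb - 1 - e) hp (coeffBound_reflect hq)
    (by omega)]

/-! ### 6. Accumulating several products in the transform domain -/

/-- A finite sum of polynomials of degree `< L` has degree `< L` (`L ≥ 1`). [folklore] -/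
private theorem natDegree_sum_lt {ι : Type*} (s : Finset ι) (f : ι → ℤ[X]) {L : ℕ} (hL : 0 < L)
    (h : ∀ t ∈ s, (f t).natDegree < L) : (∑ t ∈ s, f t).natDegree < L := by
  refine Finset.sum_induction f (fun r => r.natDegree < L) (fun a b ha hb => ?_)
    (by simpa using hL) h
  exact lt_of_le_of_lt (natDegree_add_le a b) (max_lt ha hb)

/-- Multiply-accumulate in the transform domain: a sum of products of packed integers is the
packing of the sum of the product polynomials. [cite: BrentZimmermann2010, §1.3] -/
theorem sum_pack_mul_pack {ι : Type*} (B : ℕ) (s : Finset ι) (u v : ι → ℤ[X]) :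
    ∑ t ∈ s, pack B (u t) * pack B (v t) = pack B (∑ t ∈ s, u t * v t) := by
  rw [pack_sum]
  exact Finset.sum_congr rfl fun t _ => (pack_mul _ _ _).symm

/-- **Accumulation.** If the accumulated polynomial `∑_t u_t v_t` has degree `< L` and its
coefficients stay in `(-H, H)`, balanced decoding of the accumulated integer
`∑_t pack (2H) u_t · pack (2H) v_t` returns `∑_t (u_t v_t)_n` exactly (`n < L`).
[cite: BrentZimmermann2010, §1.3] [cite: Harvey2009, §3, (3.1)] -/
theorem decode_sum_pack_mul {ι : Type*} (s : Finset ι) (u v : ι → ℤ[X]) {H L : ℕ} (hH : 0 < H)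
    (hdeg : (∑ t ∈ s, u t * v t).natDegree < L)
    (hacc : ∀ n, (∑ t ∈ s, (u t * v t).coeff n).natAbs < H) {n : ℕ} (hn : n < L) :
    decode H L (∑ t ∈ s, pack (2 * H) (u t) * pack (2 * H) (v t)) n
      = ∑ t ∈ s, (u t * v t).coeff n := by
  rw [sum_pack_mul_pack, ← finsetSum_coeff]
  refine decode_pack hH hdeg (balanced_of_natAbs_lt fun k => ?_) hn
  rw [finsetSum_coeff]
  exact hacc k

/-- The accumulator's bit budget: `bits = ba + bb + size nmin + size (T - 1)` for `T` products of
sequences with `|u| < 2^ba`, `|v| < 2^bb` and shorter length `≤ nmin`.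
[cite: Harvey2009, §3, (3.1)] -/
def accBits (ba bb nmin T : ℕ) : ℕ := ba + bb + Nat.size nmin + Nat.size (T - 1)

/-- The accumulator's slot width in bytes, `max 1 ⌈(bits+1)/8⌉`.
[cite: BrentZimmermann2010, §1.3] -/
def accWidth (ba bb nmin T : ℕ) : ℕ := max 1 ((accBits ba bb nmin T + 8) / 8)

/-- **No overflow while accumulating.** The sum of at most `T` products of sequences with
`|u_j| ≤ 2^ba - 1`, `|v_k| ≤ 2^bb - 1` and `min(len u, len v) ≤ nmin` has every coefficient below
`2^(ba + bb + size nmin + size (T-1))` in absolute value. [cite: Harvey2009, §3, (3.1)] -/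
theorem natAbs_sum_coeff_mul_lt {ι : Type*} (s : Finset ι) (u v : ι → ℤ[X]) (lu lv : ι → ℕ)
    {ba bb nmin T : ℕ} (hu : ∀ t ∈ s, CoeffBound (u t) (lu t) (2 ^ ba - 1))
    (hv : ∀ t ∈ s, CoeffBound (v t) (lv t) (2 ^ bb - 1))
    (hmin : ∀ t ∈ s, min (lu t) (lv t) ≤ nmin) (hcard : s.card ≤ T) (n : ℕ) :
    (∑ t ∈ s, (u t * v t).coeff n).natAbs < 2 ^ accBits ba bb nmin T := by
  have hterm : ∀ t ∈ s, ((u t * v t).coeff n).natAbs ≤ nmin * ((2 ^ ba - 1) * (2 ^ bb - 1)) :=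
    fun t ht => (natAbs_coeff_mul_le (hu t ht) (hv t ht) n).trans
      (Nat.mul_le_mul_right _ (hmin t ht))
  have hsum : (∑ t ∈ s, (u t * v t).coeff n).natAbs ≤ T * (nmin * ((2 ^ ba - 1) * (2 ^ bb - 1))) :=
    calc (∑ t ∈ s, (u t * v t).coeff n).natAbs
        ≤ ∑ t ∈ s, ((u t * v t).coeff n).natAbs := Int.natAbs_sum_le _ _
      _ ≤ ∑ _t ∈ s, nmin * ((2 ^ ba - 1) * (2 ^ bb - 1)) := Finset.sum_le_sum hterm
      _ = s.card * (nmin * ((2 ^ ba - 1) * (2 ^ bb - 1))) := by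
          rw [Finset.sum_const, smul_eq_mul]
      _ ≤ T * (nmin * ((2 ^ ba - 1) * (2 ^ bb - 1))) := Nat.mul_le_mul_right _ hcard
  refine lt_of_le_of_lt hsum ?_
  unfold accBits
  have hT : T ≤ 2 ^ Nat.size (T - 1) := by
    have := Nat.lt_size_self (T - 1); omega
  have hn : nmin < 2 ^ Nat.size nmin := Nat.lt_size_self nmin
  have ha : 2 ^ ba - 1 < 2 ^ ba := Nat.sub_one_lt (by positivity)
  have hb : 2 ^ bb - 1 < 2 ^ bb := Nat.sub_one_lt (by positivity)
  have hprod : nmin * ((2 ^ ba - 1) * (2 ^ bb - 1)) < 2 ^ Nat.size nmin * (2 ^ ba * 2 ^ bb) :=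
    Nat.mul_lt_mul'' hn (Nat.mul_lt_mul'' ha hb)
  have hpos : 0 < 2 ^ Nat.size (T - 1) := by positivity
  calc T * (nmin * ((2 ^ ba - 1) * (2 ^ bb - 1)))
      ≤ 2 ^ Nat.size (T - 1) * (nmin * ((2 ^ ba - 1) * (2 ^ bb - 1))) :=
        Nat.mul_le_mul_right _ hT
    _ < 2 ^ Nat.size (T - 1) * (2 ^ Nat.size nmin * (2 ^ ba * 2 ^ bb)) :=
        Nat.mul_lt_mul_of_pos_left hprod hpos
    _ = 2 ^ (ba + bb + Nat.size nmin + Nat.size (T - 1)) := by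
        rw [pow_add, pow_add, pow_add]; ring

/-- The accumulator's width rule: `2^bits ≤ H = 2^(8W-1)` and `W ≥ 1`.
[cite: BrentZimmermann2010, §1.3] -/
theorem two_pow_accBits_le_half (ba bb nmin T : ℕ) :
    2 ^ accBits ba bb nmin T ≤ half (accWidth ba bb nmin T) ∧ 1 ≤ accWidth ba bb nmin T := by
  unfold half accWidth
  refine ⟨Nat.pow_le_pow_right (by norm_num) ?_, le_max_left _ _⟩
  omega

/-- **The kernel's accumulate-then-decode is exact.** For at most `T` products `u_t v_t` of
bounded sequences as in `natAbs_sum_coeff_mul_lt`, with `W = accWidth ba bb nmin T`,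
`H = 2^(8W-1)`, any slot count `L` exceeding all product lengths, and `n < L`:
`∑_t (u_t v_t)_n = decode H L (∑_t pack (256^W) u_t · pack (256^W) v_t) n`.
[cite: BrentZimmermann2010, §1.3] [cite: Harvey2009, §3, (3.1)] -/
theorem acc_eq_decode {ι : Type*} (s : Finset ι) (u v : ι → ℤ[X]) (lu lv : ι → ℕ)
    {ba bb nmin T L : ℕ} (hu : ∀ t ∈ s, CoeffBound (u t) (lu t) (2 ^ ba - 1))
    (hv : ∀ t ∈ s, CoeffBound (v t) (lv t) (2 ^ bb - 1))
    (hmin : ∀ t ∈ s, min (lu t) (lv t) ≤ nmin) (hcard : s.card ≤ T)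
    (hL : ∀ t ∈ s, lu t + lv t - 1 ≤ L) (hL0 : 0 < L) {n : ℕ} (hn : n < L) :
    ∑ t ∈ s, (u t * v t).coeff n = decode (half (accWidth ba bb nmin T)) L
      (∑ t ∈ s, pack (256 ^ accWidth ba bb nmin T) (u t)
        * pack (256 ^ accWidth ba bb nmin T) (v t)) n := by
  obtain ⟨hle, hW⟩ := two_pow_accBits_le_half ba bb nmin T
  rw [← two_mul_half hW, decode_sum_pack_mul s u v (half_pos _)
    (natDegree_sum_lt s _ hL0 fun t ht => lt_of_lt_of_le ((hu t ht).mul (hv t ht)).1 (hL t ht))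
    (fun k => lt_of_lt_of_le (natAbs_sum_coeff_mul_lt s u v lu lv hu hv hmin hcard k) hle) hn]

/-! ### 7. Length recovery from the bit length -/

/-- A balanced expansion is dominated by its top digit: if `|c_i| < H` for all `i`, then
`2 |∑_{i<m} c_i (2H)^i| < (2H)^m`. [cite: KnuthTAOCP2, §4.1] -/
theorem two_mul_abs_sum_lt {H : ℕ} (c : ℕ → ℤ) (hc : ∀ i, (c i).natAbs < H) :
    ∀ m : ℕ, 2 * |∑ i ∈ range m, c i * (2 * H : ℤ) ^ i| < (2 * H : ℤ) ^ m
  | 0 => by simp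
  | m + 1 => by
      have ih := two_mul_abs_sum_lt c hc m
      have hcm : 2 * |c m| ≤ 2 * H - 2 := by
        rw [Int.abs_eq_natAbs]
        have := hc m
        omega
      have hH : (0 : ℤ) < 2 * H := by
        have := hc 0
        omega
      have hB : (0 : ℤ) < (2 * H : ℤ) ^ m := pow_pos hH m
      have h2 : 2 * |c m| * (2 * H : ℤ) ^ m ≤ (2 * H - 2) * (2 * H : ℤ) ^ m :=
        mul_le_mul_of_nonneg_right hcm hB.le
      rw [Finset.sum_range_succ, pow_succ]
      calc 2 * |∑ i ∈ range m, c i * (2 * H : ℤ) ^ i + c m * (2 * H : ℤ) ^ m|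
          ≤ 2 * (|∑ i ∈ range m, c i * (2 * H : ℤ) ^ i| + |c m * (2 * H : ℤ) ^ m|) := by
            gcongr
            exact abs_add_le _ _
        _ = 2 * |∑ i ∈ range m, c i * (2 * H : ℤ) ^ i| + 2 * |c m| * (2 * H : ℤ) ^ m := by
            rw [abs_mul, abs_of_pos hB]
            ring
        _ < (2 * H : ℤ) ^ m + (2 * H - 2) * (2 * H : ℤ) ^ m := by linarith
        _ < (2 * H : ℤ) ^ m * (2 * H) := by nlinarith

/-- **The packed integer reveals its length.** If `p ≠ 0` and `|c_i| < H` for all `i`, then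
`(2H)^(deg p) < 2 |pack (2H) p|`: the leading balanced digit outweighs all lower ones.
[cite: KnuthTAOCP2, §4.1] -/
theorem base_pow_natDegree_lt (hp0 : p ≠ 0) {H : ℕ} (hc : ∀ i, (p.coeff i).natAbs < H) :
    (2 * H) ^ p.natDegree < 2 * (pack (2 * H) p).natAbs := by
  have hlead : 1 ≤ |p.coeff p.natDegree| := Int.one_le_abs (leadingCoeff_ne_zero.2 hp0)
  have hH : (0 : ℤ) < 2 * H := by
    have := hc 0
    omega
  have hB : (0 : ℤ) < (2 * H : ℤ) ^ p.natDegree := pow_pos hH _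
  have hlow := two_mul_abs_sum_lt (fun i => p.coeff i) hc p.natDegree
  have hsum : pack (2 * H) p = ∑ i ∈ range p.natDegree, p.coeff i * (2 * H : ℤ) ^ i
      + p.coeff p.natDegree * (2 * H : ℤ) ^ p.natDegree := by
    rw [pack_eq_sum _ (Nat.lt_succ_self _), Finset.sum_range_succ]
    push_cast
    ring
  have hZ : (2 * H : ℤ) ^ p.natDegree < 2 * |pack (2 * H) p| := by
    rw [hsum]
    have htri := abs_sub_abs_le_abs_sub (p.coeff p.natDegree * (2 * H : ℤ) ^ p.natDegree)
      (-(∑ i ∈ range p.natDegree, p.coeff i * (2 * H : ℤ) ^ i))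
    rw [abs_neg, sub_neg_eq_add, add_comm, abs_mul, abs_of_pos hB] at htri
    nlinarith
  zify
  simpa using hZ

/-- **Length bound from the bit length.** With `W ≥ 1`, `H = 2^(8W-1)` and `|c_i| < H` for
all `i`: `deg p < size |pack (256^W) p| / (8W) + 2`, so `L = bitlength / (8W) + 2` slots always
suffice to decode every coefficient. [cite: KnuthTAOCP2, §4.1] -/
theorem natDegree_lt_lenBound {W : ℕ} (hW : 1 ≤ W) (hc : ∀ i, (p.coeff i).natAbs < half W) :
    p.natDegree < Nat.size (pack (256 ^ W) p).natAbs / (8 * W) + 2 := by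
  rcases eq_or_ne p 0 with rfl | hp0
  · simp
  have key := base_pow_natDegree_lt hp0 hc
  rw [two_mul_half hW] at key
  -- key : (256 ^ W) ^ deg p < 2 * |pack (256 ^ W) p|
  have key' : 2 ^ (8 * W * p.natDegree) < 2 * (pack (256 ^ W) p).natAbs := by
    rw [pow_mul, pow_mul, show (2 : ℕ) ^ 8 = 256 by norm_num]
    exact key
  rcases Nat.eq_zero_or_pos p.natDegree with h0 | hdpos
  · rw [h0]
    positivity
  have hexp : 1 ≤ 8 * W * p.natDegree := by nlinarith
  have hle : 2 ^ (8 * W * p.natDegree - 1) ≤ (pack (256 ^ W) p).natAbs := by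
    have : 2 * 2 ^ (8 * W * p.natDegree - 1) = 2 ^ (8 * W * p.natDegree) := by
      rw [← pow_succ', Nat.sub_add_cancel hexp]
    omega
  have hsz : 8 * W * p.natDegree - 1 < Nat.size (pack (256 ^ W) p).natAbs := Nat.lt_size.2 hle
  have hdiv : p.natDegree ≤ Nat.size (pack (256 ^ W) p).natAbs / (8 * W) := by
    rw [Nat.le_div_iff_mul_le (by omega)]
    have : p.natDegree * (8 * W) = 8 * W * p.natDegree := by ring
    omega
  omega

/-- **Decoding with the recovered length is exact.** With `W ≥ 1`, `H = 2^(8W-1)`,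
`|c_i| < H` for all `i` and `L = size |pack (256^W) p| / (8W) + 2`, every coefficient is
recovered, and so it is for any larger slot count `L`: `c_n = decode H L (pack (256^W) p) n`
for `n < L`. [cite: KnuthTAOCP2, §4.1] [cite: BrentZimmermann2010, §1.3 and Exercise 1.1] -/
theorem decode_pack_lenBound {W L : ℕ} (hW : 1 ≤ W) (hc : ∀ i, (p.coeff i).natAbs < half W)
    (hL : Nat.size (pack (256 ^ W) p).natAbs / (8 * W) + 2 ≤ L) {n : ℕ} (hn : n < L) :
    decode (half W) L (pack (256 ^ W) p) n = p.coeff n := by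
  have hdeg := lt_of_lt_of_le (natDegree_lt_lenBound hW hc) hL
  rw [← two_mul_half hW]
  exact decode_pack (half_pos W) hdeg (balanced_of_natAbs_lt hc) hn

/-- Coefficients beyond the recovered length vanish. [cite: KnuthTAOCP2, §4.1] -/
theorem coeff_eq_zero_of_lenBound_le {W : ℕ} (hW : 1 ≤ W)
    (hc : ∀ i, (p.coeff i).natAbs < half W) {n : ℕ}
    (hn : Nat.size (pack (256 ^ W) p).natAbs / (8 * W) + 2 ≤ n) : p.coeff n = 0 :=
  coeff_eq_zero_of_natDegree_lt (lt_of_lt_of_le (natDegree_lt_lenBound hW hc) hn)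

/-- **The kernel's decode-after-accumulate with the recovered length is exact.** For at most
`T` products of bounded sequences as in `natAbs_sum_coeff_mul_lt`, `W = accWidth ba bb nmin T`,
`H = 2^(8W-1)`, the accumulated integer `acc = ∑_t pack (256^W) u_t · pack (256^W) v_t` and ANY
slot count `L ≥ size |acc| / (8W) + 2`: `∑_t (u_t v_t)_n = decode H L acc n` for all `n < L`.
[cite: KnuthTAOCP2, §4.1] [cite: BrentZimmermann2010, §1.3] [cite: Harvey2009, §3, (3.1)] -/
theorem acc_eq_decode_lenBound {ι : Type*} (s : Finset ι) (u v : ι → ℤ[X]) (lu lv : ι → ℕ)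
    {ba bb nmin T L : ℕ} (hu : ∀ t ∈ s, CoeffBound (u t) (lu t) (2 ^ ba - 1))
    (hv : ∀ t ∈ s, CoeffBound (v t) (lv t) (2 ^ bb - 1))
    (hmin : ∀ t ∈ s, min (lu t) (lv t) ≤ nmin) (hcard : s.card ≤ T)
    (hL : Nat.size (∑ t ∈ s, pack (256 ^ accWidth ba bb nmin T) (u t)
        * pack (256 ^ accWidth ba bb nmin T) (v t)).natAbs / (8 * accWidth ba bb nmin T) + 2 ≤ L)
    {n : ℕ} (hn : n < L) :
    ∑ t ∈ s, (u t * v t).coeff n = decode (half (accWidth ba bb nmin T)) L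
      (∑ t ∈ s, pack (256 ^ accWidth ba bb nmin T) (u t)
        * pack (256 ^ accWidth ba bb nmin T) (v t)) n := by
  obtain ⟨hle, hW⟩ := two_pow_accBits_le_half ba bb nmin T
  have hc : ∀ i, ((∑ t ∈ s, u t * v t).coeff i).natAbs < half (accWidth ba bb nmin T) :=
    fun i => by
      rw [finsetSum_coeff]
      exact lt_of_lt_of_le (natAbs_sum_coeff_mul_lt s u v lu lv hu hv hmin hcard i) hle
  rw [sum_pack_mul_pack] at hL ⊢
  rw [← finsetSum_coeff, decode_pack_lenBound hW hc hL hn]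

end Literature.Algebra.Polynomial.KroneckerSubstitution
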